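/-
Copyright (c) 2026 the pub-hodgecm-mathlib formalisation cell (harness21).  Prover seat hodgecm-mathlib-LH4-p12 (g8), req620 Track A «(D-RAM) FOUR-FRAME» squad
((β₂) road (R-36) «PURE-CELL LEDGER»; β₂-BOARD sub-dealer LH4-p04 (g8) DEAL 16:12:35Z row (AX-0) «THE AXIS COLUMN IS ZERO»; dealer∕pen LH4-plan (g14) WORD #126 (b)), 2026-09-04.
-/
import Summits.HodgeConjecture.HodgeConjecture.Theorems.F0P3cDyRamGlueLabelExchangeNearOne   -- ★ p861368 (LH4-p15 (g0)): brings ★ p861311 `valueSet_endoGL_sub_one_glued_map_eq_image_mul_of_v_sub_one_le`, ★ p861154 face lemmas, ★ p860839 `smul_mem_levelSet_iff_of_flip`, ★ DEFS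
import Summits.HodgeConjecture.HodgeConjecture.Theorems.F0P3cDyRamLineModelSimilitude         -- ★ (LH4-p15 (g0)): `exists_matrix_mulVec_eq_mul`, `pairing_mulVec_mulVec_eq_mul_of_lineModel`, `mul_eq_mul_of_lineModel`, `map_map_toLin'_eq_smul`
import Summits.HodgeConjecture.HodgeConjecture.Theorems.F0P3cDyRamShellLineModel               -- ★ p861579 (LH4-p16 (g0)): `isOrd_mul` (orders are closed under multiplication)
import Literature.NumberTheory.Automorphic.UnitaryLatticeTreeAxisEndoFrame                       -- ★ `map_endoGL_sub_one_latt_endoGL_le_scaleLattice_iff`, `…_sq_…`, `mapGL_endoGL_latt_endoGL_eq_iff`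
import Literature.NumberTheory.Automorphic.UnitaryLatticeTreeAxisEndoFrameBasis                  -- ★ `mem_latt_endoGL_one_iff`, `pairing_endoShape_apply`
import HarnessLib

/-!
# Crux `H413`, line LH4 «(D-RAM) FOUR-FRAME» — STAGE-1b, row (2) of `f_{T₊}`, the (β₂) road «PURE-CELL LEDGER» (R-36): β₂-BOARD row (AX-0) «THE AXIS COLUMN IS ZERO» —
# on every axis cell `levelSet ρ Θ α (jE ϖ) h j a` of the line model the labelled difference `#{q₀₊} − #{q₀₋′}` of ★ p861305 §3 VANISHES, by the ω-flip exchange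

Cell `hodgecm-mathlib` (D-0151), FLOOR 0, crux item H413 = `stmt-HodgeConjecture-24833`, route of record `HCCMUnconditional`; squad F0∕P3c∕LH4; lane
`--supports stmt-HodgeConjecture-24833 --as helper` (count-neutral; pays NO tier-0 row).  THEOREMS ONLY (no `def`, no instance, no notation, no `sorry`, default heartbeats);
★-only imports; states NO law; (β₂) stays a HYPOTHESIS.  DATUM-FREE over ★ (C1)'s block-frame binders (`H₂, hW, γ₂, u, φ, jE, ρ, Θ, α, lam, h`) — BOTH literals at once.

WHY (β₂-BOARD v1 (LH4-p04 (g8)) §0∕§1; COVERAGE CHECK 16:09:32Z (1)).  After ★ p861305 `transvPlus_sub_cleanMinus_block_eq_cells` the literal's `T₊ − T−′` is a sum over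
cells; the AXIS column `b = 0` contributes, per order level `j`, `cellDiff(j,0) = #(levelSet(j,0) ∩ q₀₊) − #(levelSet(j,0) ∩ q₀₋′)` with the CONCRETE labels
`q₀₊ Λ :↔ ∃ g₂, φ(latt g₂) = Λ ∧ shell(ℓ, m*)(Γ − 1)(latt ι(g₂,1)) ∧ VS_{m*}(latt ι(g₂,1)) = V₊(d)` and
`q₀₋′ Λ :↔ ∃ g₂, φ(latt g₂) = Λ ∧ shell(ℓ, m_c)(Γ − 1)(latt ι(g₂,1)) ∧ ¬ VS_{m*}(latt ι(g₂,1)) = V₊(d)` (`Γ = ι(γ₂, u)`, `VS_m(L) = {z ∣ ∃ y ∈ L, |(ϖ^m)⁻¹(z − ⟨y, (Γ−1)y⟩_H)| ≤ 1}`,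
`V₊(d) = valueSetMod σ ϖ m* X₊`, `m* = mstarOfRecord d`).  THIS FILE: `cellDiff(j, a) = 0` on EVERY axis∕level cell, from
* the ω-FLIP `Λ ↦ ε • Λ` of the line model (`ε·Θε = jE ξ`, `ξ` a `σ`-fixed NON-norm unit of `E`): cell preservation ★ p860839 `smul_mem_levelSet_iff_of_flip`; as a PLANE
  similitude `gε` (★ `exists_matrix_mulVec_eq_mul`: `φ(gε x) = ε φ x`, multiplier `ξ`, commutes with `γ₂`) it carries the vertex `latt ι(g₂,1)` to `latt ι(gε g₂,1)`, PRESERVES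
  the two shell tokens (§2: `(Γ−1)^k` commutes with `ι(gε,1)`; ★ `map_endoGL_sub_one[_sq]_latt_endoGL_le_scaleLattice_iff`) and MULTIPLIES THE LETTER BY `ξ` (§3: ★ p861311 at
  the axis presentation `b = 0, w₀ = 0, x₀ = e_W`; integrality of the vertex from the cell's `Y ∈ 𝒪_j` clause, ★ DEFS `forall_mem_herm_iff_exists`);
* the FACE at the value-set level (★ p861154 §2: `ξ·V₊ = V₋′`, and `ξ·S = V₊ ↔ ¬ S = V₊` given an (A″) witness);
* TWO per-cell label facts taken as HYPOTHESES in the shapes of the ★ laws (α′)∕(A″) — `hclean` («`+` on the `m*`-shell ⇒ clean at `m_c`», (α′)₂ = ★ p860419's shape) and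
  `hdich` («on the clean shell the letter is `valueSetMod σ ϖ m* (e • X₊)` for a `σ`-fixed unit `e`», (A″)'s shape) — the sub-dealer's «label equivalences on the cell, bridged on my
  side (★ p860337 ∕ ★ p860419)»; at a level where NO vertex is on the `m*`-shell both hypotheses and both labelled parts are vacuous (the «unlabelled∕empty» levels: `= 0` all the same).
HONEST LABEL.  Count-neutral lattice ∕ norm-class bookkeeping; nothing printed is asserted; no census law is stated; (β₂), `beta2Cells` and the two cell hypotheses stay HYPOTHESES;
`HC_CM` is proved only modulo the 7 printed citations (2 remaining named inputs: hLiu418 = `stmt-HodgeConjecture-24832`, h413 = `stmt-HodgeConjecture-24833`) until rung 0 closes.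
## References
* [Kottwitz1986BaseChangeUnits] R. E. Kottwitz, *Base change for unit elements of Hecke algebras*, Compositio Math. 60 (1986): §1 pp. 240–241 (signed lattice counts, cell by cell).
* [Rogawski1990] J. D. Rogawski, *Automorphic Representations of Unitary Groups in Three Variables*, Ann. of Math. Stud. 123 (1990): §4.9 Prop. 4.9.1 (b) p. 55 (the labelled census of `f_{T₊}`).
* [LabesseLanglands1979] J.-P. Labesse, R. P. Langlands, *L-indistinguishability for SL(2)*, Canad. J. Math. 31 (1979): §2 p. 8 (sign-reversing involutions).
* [Serre1979] J.-P. Serre, *Local Fields*, GTM 67 (1979): Ch. V §3 Cor. 3 (norm classes of units: index two).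
* [Jacobowitz1962] R. Jacobowitz, *Hermitian forms over local fields*, Amer. J. Math. 84 (1962): §4 (similitudes, dual lattices).
-/

set_option autoImplicit false

noncomputable section

namespace Summit.HodgeConjecture.HodgeConjecture.Cruxes.H413.F0P3cDyRamAxisColumnZero

open scoped Valued WithZero Matrix MatrixGroups Pointwise
open WithZero
open Literature.NumberTheory.Automorphic Literature.NumberTheory.Automorphic.HermitianLattice Literature.NumberTheory.Automorphic.UnitaryLatticeTree
open Literature.NumberTheory.Automorphic.UnitaryThreeFourFrame (IsRamifiedQuadraticDatum)
open Literature.NumberTheory.Rogawski1990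
open Summit.HodgeConjecture.HodgeConjecture.Cruxes.H413.F0P3cDyRamFourFramePieces
open Summit.HodgeConjecture.HodgeConjecture.Cruxes.H413.F0P3cDyRamFourFrameCensusDefs (LatticeInLevel LatticeNearTransvShell)
open Summit.HodgeConjecture.HodgeConjecture.Cruxes.H413.F0P3cDyRamToricCensusDefs
open Summit.HodgeConjecture.HodgeConjecture.Cruxes.H413.F0P3cDyRamConeCellFlipBalance
open Summit.HodgeConjecture.HodgeConjecture.Cruxes.H413.F0P3cDyRamConeCellFaceAxis
open Summit.HodgeConjecture.HodgeConjecture.Cruxes.H413.F0P3cDyRamGlueValueDepthForm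
open Summit.HodgeConjecture.HodgeConjecture.Cruxes.H413.F0P3cDyRamLineModelSimilitude
open Summit.HodgeConjecture.HodgeConjecture.Cruxes.H413.F0P3cDyRamShellLineModel (isOrd_mul)

variable {E : Type} {M : Type*} [Field E] [Valued E ℤᵐ⁰] [Field M] [Valued M ℤᵐ⁰] {σ : E →+* E} {ϖ : E} {d t : ℕ} {ρ Θ : M →+* M} {α : M}

/-! ## §1 The ω-flip of the line model as an element of `GL₂(E)` -/

omit [Valued E ℤᵐ⁰] [Valued M ℤᵐ⁰] in
/-- **MULTIPLICATION BY A NON-ZERO `z ∈ M` IS AN INVERTIBLE MATRIX OF THE PLANE**: ★ `exists_matrix_mulVec_eq_mul` for `z` and `z⁻¹` give mutually inverse matrices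
(`φ` injective), hence `g ∈ GL₂(E)` with `φ(g x) = z·φ x`. [cite: Jacobowitz1962, §4] -/
theorem exists_GL_mulVec_eq_mul (jE : E →+* M) (φ : (Fin 2 → E) →+ M) (hφs : ∀ (c : E) (x : Fin 2 → E), φ (c • x) = jE c * φ x)
    (hφi : Function.Injective φ) (hφo : Function.Surjective φ) {z : M} (hz : z ≠ 0) :
    ∃ g : GL (Fin 2) E, ∀ x : Fin 2 → E, φ ((g : Matrix (Fin 2) (Fin 2) E) *ᵥ x) = z * φ x := by
  obtain ⟨ε, hε⟩ := exists_matrix_mulVec_eq_mul jE φ hφs hφi hφo z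
  obtain ⟨ε', hε'⟩ := exists_matrix_mulVec_eq_mul jE φ hφs hφi hφo z⁻¹
  have h1 : ε * ε' = 1 := by
    refine Matrix.toLin'.injective (LinearMap.ext fun x => ?_)
    rw [Matrix.toLin'_apply, Matrix.toLin'_apply, ← Matrix.mulVec_mulVec, Matrix.one_mulVec]
    apply hφi
    rw [hε, hε', ← mul_assoc, mul_inv_cancel₀ hz, one_mul]
  have h2 : ε' * ε = 1 := by
    refine Matrix.toLin'.injective (LinearMap.ext fun x => ?_)
    rw [Matrix.toLin'_apply, Matrix.toLin'_apply, ← Matrix.mulVec_mulVec, Matrix.one_mulVec]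
    apply hφi
    rw [hε', hε, ← mul_assoc, inv_mul_cancel₀ hz, one_mul]
  exact ⟨⟨ε, ε', h1, h2⟩, hε⟩

omit [Valued E ℤᵐ⁰] [Field M] [Valued M ℤᵐ⁰] in
/-- `ι(g·g₂, 1) = ι(g, 1)·ι(g₂, 1)` (`ι = endoGL` is a homomorphism). [cite: Rogawski1990, §4.8 Case (a) p. 53] -/
theorem endoGL_mul_one (g g₂ : GL (Fin 2) E) :
    (endoGL (g * g₂, (1 : GL (Fin 1) E)) : GL (Fin 3) E) = endoGL (g, (1 : GL (Fin 1) E)) * endoGL (g₂, (1 : GL (Fin 1) E)) := by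
  rw [← map_mul, Prod.mk_mul_mk, mul_one]

omit [Valued E ℤᵐ⁰] [Field M] [Valued M ℤᵐ⁰] in
/-- A plane matrix commuting with `γ₂` gives a block matrix `ι(g, 1)` commuting with `Γ = ι(γ₂, u)`, hence with `Γ − 1`. [cite: Rogawski1990, §4.8 Case (a) p. 53] -/
theorem endoGL_sub_one_mul_endoGL_one_comm {g γ₂ : GL (Fin 2) E} (hgγ : (g : Matrix (Fin 2) (Fin 2) E) * (γ₂ : Matrix (Fin 2) (Fin 2) E) = (γ₂ : Matrix (Fin 2) (Fin 2) E) * g)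
    (u : GL (Fin 1) E) :
    ((((endoGL (γ₂, u) : GL (Fin 3) E) : Matrix (Fin 3) (Fin 3) E) - 1)) * ((endoGL (g, (1 : GL (Fin 1) E)) : GL (Fin 3) E) : Matrix (Fin 3) (Fin 3) E) =
      ((endoGL (g, (1 : GL (Fin 1) E)) : GL (Fin 3) E) : Matrix (Fin 3) (Fin 3) E) * ((((endoGL (γ₂, u) : GL (Fin 3) E) : Matrix (Fin 3) (Fin 3) E) - 1)) := by
  have hGL : g * γ₂ = γ₂ * g := Units.ext hgγ
  have hcomm : ((endoGL (γ₂, u) : GL (Fin 3) E) : Matrix (Fin 3) (Fin 3) E) * ((endoGL (g, (1 : GL (Fin 1) E)) : GL (Fin 3) E) : Matrix (Fin 3) (Fin 3) E) =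
      ((endoGL (g, (1 : GL (Fin 1) E)) : GL (Fin 3) E) : Matrix (Fin 3) (Fin 3) E) * ((endoGL (γ₂, u) : GL (Fin 3) E) : Matrix (Fin 3) (Fin 3) E) := by
    rw [← Units.val_mul, ← Units.val_mul, ← map_mul, ← map_mul, Prod.mk_mul_mk, Prod.mk_mul_mk, mul_one, one_mul, hGL]
  rw [sub_mul, mul_sub, one_mul, mul_one, hcomm]

/-! ## §2 Lattice transport under a matrix commuting with `X`: the level tokens and the shell are invariant -/

omit [Field M] [Valued M ℤᵐ⁰] in
/-- **A LEVEL TOKEN IS INVARIANT UNDER A COMMUTING TRANSLATE**: `X·(G·L) ⊆ ϖ^k·(G·L) ⟺ X·L ⊆ ϖ^k·L` when `X G = G X` (`G ∈ GL₃`).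
[cite: Kottwitz1986BaseChangeUnits, §1 pp. 240–241] -/
theorem latticeInLevel_mapGL_iff_of_comm (G : GL (Fin 3) E) {X : Matrix (Fin 3) (Fin 3) E}
    (hX : X * (G : Matrix (Fin 3) (Fin 3) E) = (G : Matrix (Fin 3) (Fin 3) E) * X) (ϖ : E) (k : ℕ) (L : Submodule 𝒪[E] (Fin 3 → E)) :
    LatticeInLevel ϖ k X (mapGL G L) ↔ LatticeInLevel ϖ k X L := by
  unfold LatticeInLevel mapGL
  rw [← map_toLin'_mul, hX, map_toLin'_mul, scaleLattice_map]
  exact mapGL_le_mapGL_iff G _ _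

omit [Field M] [Valued M ℤᵐ⁰] in
/-- **THE NEAR-TRANSVECTION SHELL IS INVARIANT UNDER A COMMUTING TRANSLATE** (both level tokens of `X` and the one of `X²`). [cite: Kottwitz1986BaseChangeUnits, §1 pp. 240–241] -/
theorem latticeNearTransvShell_mapGL_iff_of_comm (G : GL (Fin 3) E) {X : Matrix (Fin 3) (Fin 3) E}
    (hX : X * (G : Matrix (Fin 3) (Fin 3) E) = (G : Matrix (Fin 3) (Fin 3) E) * X) (ϖ : E) (ℓ m : ℕ) (L : Submodule 𝒪[E] (Fin 3 → E)) :
    LatticeNearTransvShell ϖ ℓ m X (mapGL G L) ↔ LatticeNearTransvShell ϖ ℓ m X L := by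
  have hXX : X * X * (G : Matrix (Fin 3) (Fin 3) E) = (G : Matrix (Fin 3) (Fin 3) E) * (X * X) := by
    rw [mul_assoc, hX, ← mul_assoc, hX, mul_assoc]
  unfold LatticeNearTransvShell
  rw [latticeInLevel_mapGL_iff_of_comm G hX, latticeInLevel_mapGL_iff_of_comm G hX, latticeInLevel_mapGL_iff_of_comm G hXX]

omit [Field M] [Valued M ℤᵐ⁰] in
/-- Antitonicity of the level token in the exponent: `X·L ⊆ ϖ^{k′}·L ⇒ X·L ⊆ ϖ^k·L` for `k ≤ k′` (`|ϖ| ≤ 1`). [cite: Kottwitz1986BaseChangeUnits, §1 pp. 240–241] -/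
theorem latticeInLevel_of_le' {ϖ : E} (hϖ1 : Valued.v ϖ ≤ 1) {k k' : ℕ} (hk : k ≤ k') {X : Matrix (Fin 3) (Fin 3) E} {L : Submodule 𝒪[E] (Fin 3 → E)}
    (h : LatticeInLevel ϖ k' X L) : LatticeInLevel ϖ k X L :=
  le_trans h (scaleLattice_pow_antitone hϖ1 L hk)

omit [Field M] [Valued M ℤᵐ⁰] in
/-- **THE PLANE PART OF AN AXIS VERTEX**: `ι_W(latt g₂) = latt ι(g₂, 1) ∩ W` (`W = ker proj₁`; ★ `mem_map_planeMatrix_iff`, ★ `mem_latt_endoGL_one_iff`) — the `hB` letter of ★ p861311 at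
the axis presentation. [cite: Jacobowitz1962, §4] -/
theorem map_planeMatrix_latt_eq_inf_ker (g₂ : GL (Fin 2) E) :
    (latt (g₂ : Matrix (Fin 2) (Fin 2) E)).map ((Matrix.toLin' (!![1, 0; 0, 0; 0, 1] : Matrix (Fin 3) (Fin 2) E)).restrictScalars 𝒪[E]) =
      latt ((endoGL (g₂, (1 : GL (Fin 1) E)) : GL (Fin 3) E) : Matrix (Fin 3) (Fin 3) E) ⊓
        LinearMap.ker ((LinearMap.proj (1 : Fin 3) : (Fin 3 → E) →ₗ[E] E).restrictScalars 𝒪[E]) := by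
  ext w
  rw [mem_map_planeMatrix_iff, Submodule.mem_inf, mem_latt_endoGL_one_iff, mem_kerProj_one_iff]
  constructor
  · rintro ⟨hw1, hw⟩
    exact ⟨⟨hw, by rw [hw1, map_zero]; exact zero_le⟩, hw1⟩
  · rintro ⟨⟨hw, -⟩, hw1⟩
    exact ⟨hw1, hw⟩

/-! ## §3 The axis vertex over a cell member is INTEGRAL; the ω-flip MULTIPLIES ITS LETTER BY `ξ` -/

/-- **THE AXIS VERTEX OVER A CELL MEMBER IS INTEGRAL FOR THE BLOCK FORM.**  If `φ(latt g₂) = Λ ∈ levelSet ρ Θ α (jE ϖ) h j a` (so `Λ = x₀·𝒪_j` with dual generator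
`Y ∈ 𝒪_j`: `Λ ⊆ Λ^# = Y⁻¹Λ`, ★ DEFS `forall_mem_herm_iff_exists`), then `|⟨y, y⟩_H| ≤ 1` for every `y ∈ latt ι(g₂, 1)` (block form `H = ι-shape(H₂, h_W)`, `|h_W| ≤ 1`; the plane
part through ★ (C1)'s `hform`, the line part trivially). [cite: Jacobowitz1962, §4] [cite: BruhatTits1972, §10] -/
theorem v_pairing_self_le_one_of_mem_levelSet (hvσ : ∀ a, Valued.v (σ a) = Valued.v a) {ϖ : E} (hϖ0 : ϖ ≠ 0) (hϖ1 : Valued.v ϖ ≤ 1)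
    (H₂ : Matrix (Fin 2) (Fin 2) E) {hW : E} (hhW : Valued.v hW ≤ 1) (jE : E →+* M)
    (hρρ : ∀ x, ρ (ρ x) = x) (hvρ : ∀ x, Valued.v (ρ x) = Valued.v x) (hα : ρ α ≠ α) (hα1 : Valued.v α ≤ 1)
    (hint : ∀ z : M, Valued.v z ≤ 1 → Valued.v ((z - ρ z) / (α - ρ α)) ≤ 1)
    (hΘΘ : ∀ x, Θ (Θ x) = x) (hΘρ : ∀ x, Θ (ρ x) = ρ (Θ x)) (hvΘ : ∀ x, Valued.v (Θ x) = Valued.v x)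
    (hjv : ∀ c, Valued.v (jE c) ≤ 1 ↔ Valued.v c ≤ 1) (hjfix : ∀ z, ρ z = z ↔ ∃ c, jE c = z)
    (φ : (Fin 2 → E) →+ M) {h : M} (hh : h ≠ 0) (hform : ∀ x y, jE (pairing σ H₂ x y) = h * Θ (φ x) * φ y + ρ (h * Θ (φ x) * φ y))
    (j a : ℕ) {g₂ : GL (Fin 2) E} (hmem : (latt (g₂ : Matrix (Fin 2) (Fin 2) E)).toAddSubgroup.map φ ∈ levelSet ρ Θ α (jE ϖ) h j a) :
    ∀ y ∈ latt ((endoGL (g₂, (1 : GL (Fin 1) E)) : GL (Fin 3) E) : Matrix (Fin 3) (Fin 3) E),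
      Valued.v (pairing σ (!![H₂ 0 0, 0, H₂ 0 1; 0, hW, 0; H₂ 1 0, 0, H₂ 1 1] : Matrix (Fin 3) (Fin 3) E) y y) ≤ 1 := by
  intro y hy
  obtain ⟨hp, hy1⟩ := (mem_latt_endoGL_one_iff g₂ y).1 hy
  obtain ⟨x₀, hx₀, hΛ, hYO, -, -⟩ := (mem_levelSet_iff ρ Θ α (jE ϖ) h j a _).1 hmem
  -- the order parameter `cc = (jE ϖ)^j`
  have hjϖ0 : jE ϖ ≠ 0 := (map_ne_zero jE).2 hϖ0
  have hc : ρ (jE ϖ ^ j) = jE ϖ ^ j := by rw [← map_pow]; exact (hjfix _).2 ⟨ϖ ^ j, rfl⟩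
  have hc0 : jE ϖ ^ j ≠ 0 := pow_ne_zero j hjϖ0
  have hc1 : Valued.v (jE ϖ ^ j) ≤ 1 := by rw [map_pow]; exact pow_le_one₀ zero_le ((hjv ϖ).2 hϖ1)
  set Y : M := dualGen ρ Θ α (jE ϖ ^ j) h x₀ with hYdef
  have hY0 : Y ≠ 0 := by
    rw [hYdef, dualGen_def]
    exact mul_ne_zero (mul_ne_zero hh (mul_ne_zero hx₀ ((map_ne_zero Θ).2 hx₀))) (mul_ne_zero hc0 (sub_ne_zero.2 (Ne.symm hα)))
  -- the plane part `p = (y₀, y₂) ∈ latt g₂`, `φ p ∈ Λ`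
  have hφp : φ ![y 0, y 2] ∈ (latt (g₂ : Matrix (Fin 2) (Fin 2) E)).toAddSubgroup.map φ := ⟨![y 0, y 2], hp, rfl⟩
  obtain ⟨z', hz', hpz'⟩ := (hΛ _).1 hφp
  -- `φ p ∈ Λ^# = Y⁻¹Λ` since `Y ∈ 𝒪_j`
  have hdual : ∀ x ∈ (latt (g₂ : Matrix (Fin 2) (Fin 2) E)).toAddSubgroup.map φ, Valued.v (h * Θ x * φ ![y 0, y 2] + ρ (h * Θ x * φ ![y 0, y 2])) ≤ 1 :=
    (forall_mem_herm_iff_exists hρρ hvρ hα hα1 hint hΘΘ hΘρ hvΘ hc hc0 hc1 hh hx₀ hΛ _).2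
      ⟨Y * z', isOrd_mul hvρ hYO hz', by rw [hpz', mul_left_comm x₀ Y z', ← mul_assoc, inv_mul_cancel₀ hY0, one_mul]⟩
  have hplane : Valued.v (pairing σ H₂ ![y 0, y 2] ![y 0, y 2]) ≤ 1 := by
    rw [← hjv, hform]
    exact hdual _ hφp
  rw [pairing_endoShape_apply]
  refine Valuation.map_add_le _ hplane ?_
  rw [map_mul, map_mul, hvσ]
  exact mul_le_one' (mul_le_one' hy1 hhW) hy1

/-- **THE ω-FLIP MULTIPLIES THE LETTER OF AN AXIS VERTEX BY `ξ`.**  For `z ∈ M` with `z·Θz = jE ξ`, `ξ` a unit of `E`, its plane matrix `g` (`φ(g x) = z·φ x`), a block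
element `Γ = ι(γ₂, u)` with `|u₀₀ − 1| ≤ |ϖ^m|`, and a cell member `φ(latt g₂) ∈ levelSet ρ Θ α (jE ϖ) h j a`:
`VS_m(latt ι(g·g₂, 1)) = ξ · VS_m(latt ι(g₂, 1))`, `VS_m(L) = {w ∣ ∃ y ∈ L, |(ϖ^m)⁻¹(w − ⟨y, (Γ−1)y⟩_H)| ≤ 1}` — ★ p861311 `valueSet_endoGL_sub_one_glued_map_eq_image_mul_of_v_sub_one_le`
at the axis presentation `b = 0`, `B₂ = latt g₂`, `w₀ = 0`, `x₀ = e_W` (the plane similitude letters `hε`, `hεγ` from ★ `…LineModelSimilitude`; integrality of both vertices from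
`v_pairing_self_le_one_of_mem_levelSet`, the flipped one being over `z • Λ`, a cell member by ★ p860839). [cite: Jacobowitz1962, §4] [cite: Rogawski1990, §4.9 Prop. 4.9.1 (b) p. 55] -/
theorem valueSet_axis_flip_eq_image_mul (hvσ : ∀ a, Valued.v (σ a) = Valued.v a) {ϖ : E} (hϖ : Valued.v ϖ = exp (-1 : ℤ))
    (H₂ : Matrix (Fin 2) (Fin 2) E) {hW : E} (hhW : Valued.v hW ≤ 1) (jE : E →+* M)
    (hρρ : ∀ x, ρ (ρ x) = x) (hvρ : ∀ x, Valued.v (ρ x) = Valued.v x) (hα : ρ α ≠ α) (hα1 : Valued.v α ≤ 1)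
    (hint : ∀ z : M, Valued.v z ≤ 1 → Valued.v ((z - ρ z) / (α - ρ α)) ≤ 1)
    (hΘΘ : ∀ x, Θ (Θ x) = x) (hΘρ : ∀ x, Θ (ρ x) = ρ (Θ x)) (hvΘ : ∀ x, Valued.v (Θ x) = Valued.v x)
    (hjv : ∀ c, Valued.v (jE c) ≤ 1 ↔ Valued.v c ≤ 1) (hjfix : ∀ z, ρ z = z ↔ ∃ c, jE c = z)
    (hjpow : ∀ (t : E) (n : ℤ), Valued.v (jE t) = Valued.v (jE ϖ) ^ n ↔ Valued.v t = Valued.v ϖ ^ n)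
    (φ : (Fin 2 → E) →+ M) (hφi : Function.Injective φ)
    {γ₂ : GL (Fin 2) E} {lam h : M} (hφγ : ∀ x, φ ((γ₂ : Matrix (Fin 2) (Fin 2) E).mulVec x) = lam * φ x)
    (hh : h ≠ 0) (hform : ∀ x y, jE (pairing σ H₂ x y) = h * Θ (φ x) * φ y + ρ (h * Θ (φ x) * φ y))
    (u : GL (Fin 1) E) (m : ℕ) (hum : Valued.v (((u : Matrix (Fin 1) (Fin 1) E) 0 0) - 1) ≤ Valued.v (ϖ ^ m))
    {z : M} {ξ : E} (hzξ : z * Θ z = jE ξ) (hξ1 : Valued.v ξ = 1)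
    {g : GL (Fin 2) E} (hg : ∀ x : Fin 2 → E, φ ((g : Matrix (Fin 2) (Fin 2) E) *ᵥ x) = z * φ x)
    (j a : ℕ) {g₂ : GL (Fin 2) E} (hmem : (latt (g₂ : Matrix (Fin 2) (Fin 2) E)).toAddSubgroup.map φ ∈ levelSet ρ Θ α (jE ϖ) h j a) :
    {w : E | ∃ y ∈ latt ((endoGL (g * g₂, (1 : GL (Fin 1) E)) : GL (Fin 3) E) : Matrix (Fin 3) (Fin 3) E),
        Valued.v ((ϖ ^ m)⁻¹ * (w - pairing σ (!![H₂ 0 0, 0, H₂ 0 1; 0, hW, 0; H₂ 1 0, 0, H₂ 1 1] : Matrix (Fin 3) (Fin 3) E) y (((((endoGL (γ₂, u) : GL (Fin 3) E) : Matrix (Fin 3) (Fin 3) E) - 1)) *ᵥ y))) ≤ 1} =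
      (fun w => ξ * w) '' {w : E | ∃ y ∈ latt ((endoGL (g₂, (1 : GL (Fin 1) E)) : GL (Fin 3) E) : Matrix (Fin 3) (Fin 3) E),
        Valued.v ((ϖ ^ m)⁻¹ * (w - pairing σ (!![H₂ 0 0, 0, H₂ 0 1; 0, hW, 0; H₂ 1 0, 0, H₂ 1 1] : Matrix (Fin 3) (Fin 3) E) y (((((endoGL (γ₂, u) : GL (Fin 3) E) : Matrix (Fin 3) (Fin 3) E) - 1)) *ᵥ y))) ≤ 1} := by
  have hvϖ0 : Valued.v ϖ ≠ 0 := by rw [hϖ]; exact exp_ne_zero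
  have hϖ0 : ϖ ≠ 0 := fun h0 => by rw [h0, map_zero] at hvϖ0; exact hvϖ0 rfl
  have hϖ1 : Valued.v ϖ ≤ 1 := by rw [hϖ, ← exp_zero, exp_le_exp]; norm_num
  -- the flipped plane lattice presents the cell member `z • Λ`
  have hρξ : ρ (jE ξ) = jE ξ := (hjfix _).2 ⟨ξ, rfl⟩
  have hξM1 : Valued.v (jE ξ) = 1 := by
    have h0 := (hjpow ξ 0).2 (by rw [zpow_zero]; exact hξ1)
    rwa [zpow_zero] at h0
  have hlatt : latt (((g * g₂ : GL (Fin 2) E)) : Matrix (Fin 2) (Fin 2) E) =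
      (latt (g₂ : Matrix (Fin 2) (Fin 2) E)).map ((Matrix.toLin' (g : Matrix (Fin 2) (Fin 2) E)).restrictScalars 𝒪[E]) := by
    rw [Units.val_mul, latt_mul]
  have hmem' : (latt (((g * g₂ : GL (Fin 2) E)) : Matrix (Fin 2) (Fin 2) E)).toAddSubgroup.map φ ∈ levelSet ρ Θ α (jE ϖ) h j a := by
    rw [hlatt, map_map_toLin'_eq_smul φ hg]
    exact (smul_mem_levelSet_iff_of_flip hzξ hρξ hξM1 (jE ϖ) h j a _).2 hmem
  -- the letters of ★ p861311 at the axis presentation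
  have hpr : ∀ g' : GL (Fin 2) E, ∀ x ∈ latt ((endoGL (g', (1 : GL (Fin 1) E)) : GL (Fin 3) E) : Matrix (Fin 3) (Fin 3) E),
      Valued.v (x 1) * Valued.v ϖ ^ 0 ≤ 1 := fun g' x hx => by
    rw [pow_zero, mul_one]; exact ((mem_latt_endoGL_one_iff g' x).1 hx).2
  have hx₀ : ∀ g' : GL (Fin 2) E, (Pi.single 1 1 : Fin 3 → E) ∈ latt ((endoGL (g', (1 : GL (Fin 1) E)) : GL (Fin 3) E) : Matrix (Fin 3) (Fin 3) E) := fun g' => by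
    rw [mem_latt_endoGL_one_iff]
    have e : (![(Pi.single 1 1 : Fin 3 → E) 0, (Pi.single 1 1 : Fin 3 → E) 2] : Fin 2 → E) = 0 := by ext i; fin_cases i <;> simp
    rw [e]
    exact ⟨Submodule.zero_mem _, by simp⟩
  have hx₀1 : Valued.v ((Pi.single 1 1 : Fin 3 → E) 1) * Valued.v ϖ ^ 0 = 1 := by simp
  have hprx : (Pi.single 1 1 : Fin 3 → E) - Pi.single 1 ((Pi.single 1 1 : Fin 3 → E) 1) = ![(0 : Fin 2 → E) 0, 0, (0 : Fin 2 → E) 1] := by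
    ext i; fin_cases i <;> simp
  have hprx' : (Pi.single 1 1 : Fin 3 → E) - Pi.single 1 ((Pi.single 1 1 : Fin 3 → E) 1) =
      ![((g : Matrix (Fin 2) (Fin 2) E) *ᵥ (0 : Fin 2 → E)) 0, 0, ((g : Matrix (Fin 2) (Fin 2) E) *ᵥ (0 : Fin 2 → E)) 1] := by
    rw [Matrix.mulVec_zero]; ext i; fin_cases i <;> simp
  have hB' : ((latt (g₂ : Matrix (Fin 2) (Fin 2) E)).map ((Matrix.toLin' (g : Matrix (Fin 2) (Fin 2) E)).restrictScalars 𝒪[E])).map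
        ((Matrix.toLin' (!![1, 0; 0, 0; 0, 1] : Matrix (Fin 3) (Fin 2) E)).restrictScalars 𝒪[E]) =
      latt ((endoGL (g * g₂, (1 : GL (Fin 1) E)) : GL (Fin 3) E) : Matrix (Fin 3) (Fin 3) E) ⊓
        LinearMap.ker ((LinearMap.proj (1 : Fin 3) : (Fin 3 → E) →ₗ[E] E).restrictScalars 𝒪[E]) := by
    rw [← hlatt]; exact map_planeMatrix_latt_eq_inf_ker (g * g₂)
  exact valueSet_endoGL_sub_one_glued_map_eq_image_mul_of_v_sub_one_le σ hϖ H₂ hW (hpr g₂) (hpr (g * g₂))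
    (v_pairing_self_le_one_of_mem_levelSet hvσ hϖ0 hϖ1 H₂ hhW jE hρρ hvρ hα hα1 hint hΘΘ hΘρ hvΘ hjv hjfix φ hh hform j a hmem)
    (v_pairing_self_le_one_of_mem_levelSet hvσ hϖ0 hϖ1 H₂ hhW jE hρρ hvρ hα hα1 hint hΘΘ hΘρ hvΘ hjv hjfix φ hh hform j a hmem')
    (w₀ := 0) hξ1 (pairing_mulVec_mulVec_eq_mul_of_lineModel σ H₂ jE hjfix φ hform hg hzξ) γ₂ (mul_eq_mul_of_lineModel φ hφi hφγ hg) u m hum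
    (map_planeMatrix_latt_eq_inf_ker g₂) hB' (hx₀ g₂) (hx₀ (g * g₂)) hx₀1 hx₀1 hprx hprx'

/-! ## §4 The exchange bookkeeping (★ LH7-p09 `…CellDiffZero` §2 shape, inlined) -/

omit [Field E] [Valued E ℤᵐ⁰] [Field M] [Valued M ℤᵐ⁰] in
/-- **EXCHANGE ⇒ THE CELL DIFFERENCE VANISHES**: a cell-preserving bijection `τ` with `P → Q ∘ τ` and `Q → P ∘ τ⁻¹` on the cell makes `#(S ∩ {P}) = #(S ∩ {Q})`
(★ LH7-p09 `natCast_ncard_sub_eq_zero_of_exchange`, restated to keep the import list ★-minimal). [cite: Kottwitz1986BaseChangeUnits, §1 pp. 240–241] [cite: LabesseLanglands1979, §2 p. 8] -/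
theorem natCast_ncard_inter_sub_eq_zero_of_equiv {X : Type*} (S : Set X) (τ : X ≃ X) (hτ : ∀ x, τ x ∈ S ↔ x ∈ S) (P Q : X → Prop)
    (hPQ : ∀ x ∈ S, P x → Q (τ x)) (hQP : ∀ y ∈ S, Q y → P (τ.symm y)) :
    ((S ∩ {x | P x}).ncard : ℤ) - ((S ∩ {x | Q x}).ncard : ℤ) = 0 := by
  rw [sub_eq_zero, Nat.cast_inj]
  refine Set.ncard_congr (fun x _ => τ x) (fun x hx => ⟨(hτ x).2 hx.1, hPQ x hx.1 hx.2⟩) (fun a b _ _ hab => τ.injective hab) (fun y hy => ?_)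
  have hyS : τ.symm y ∈ S := (hτ (τ.symm y)).1 (by rw [τ.apply_symm_apply]; exact hy.1)
  exact ⟨τ.symm y, ⟨hyS, hQP y hy.1 hy.2⟩, τ.apply_symm_apply y⟩

/-! ## §5 HEAD — (AX-0): the axis cell difference vanishes -/

/-- **(AX-0) «THE AXIS COLUMN IS ZERO» — `cellDiff(j, a) = 0` ON EVERY CELL `levelSet ρ Θ α (jE ϖ) h j a` OF THE LINE MODEL.**  Frame: ★ (C1)'s block-frame binders (plane
`(E², H₂)` with `σ`, `|ϖ| = exp(−1)` from the sheet datum `hD`, line `hW` with `|hW| ≤ 1`, block element `Γ = ι(γ₂, u)` near `1`: `hum : |u₀₀ − 1| ≤ |ϖ^{m*}|`; line model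
`(M, jE, ρ, Θ, α; φ, lam, h)` with `hφs hφi hφo hφγ hform`, `ρ`∕`Θ` letters of ★ DEFS), an ω-FLIP `ε ∈ M`, `ε·Θε = jE ξ` with `ξ` a `σ`-fixed NON-norm unit of `E` (where every `ρ`- and `Θ`-fixed unit of `M` is a `Θ`-norm, ★ `exists_flipUnit_of_forall_fixed_fixed_isNorm`
supplies one, `|ξ| = 1` by `hjpow` — ★ p861154's head), the shell
parameters `ℓ` and `m_c ≥ m* = mstarOfRecord d`, and the two per-cell label facts `hclean` ((α′)-shape: a `+`-labelled vertex on the `(ℓ, m*)`-shell is clean at `m_c`) and `hdich`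
((A″)-shape: on the clean `(ℓ, m_c)`-shell the letter is `valueSetMod σ ϖ m* (e • X₊)` for a `σ`-fixed unit `e`).  THEN, in ★ p861305 §3's byte shape,
`(#(levelSet … j a ∩ {Λ ∣ ∃ g₂, φ(latt g₂) = Λ ∧ shell(ℓ,m*) ∧ VS_{m*} = V₊}) : ℤ) − #(levelSet … j a ∩ {Λ ∣ ∃ g₂, φ(latt g₂) = Λ ∧ shell(ℓ,m_c) ∧ ¬ VS_{m*} = V₊}) = 0`.
[cite: Kottwitz1986BaseChangeUnits, §1 pp. 240–241] [cite: Rogawski1990, §4.9 Prop. 4.9.1 (b) p. 55] [cite: LabesseLanglands1979, §2 p. 8] [cite: Serre1979, Ch. V §3 Cor. 3] -/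
theorem natCast_ncard_axisCell_plus_sub_cleanMinus_eq_zero [CompleteSpace E] [Finite 𝓀[E]] (hD : IsRamifiedQuadraticDatum σ ϖ d t)
    (H₂ : Matrix (Fin 2) (Fin 2) E) {hW : E} (hhW : Valued.v hW ≤ 1) (jE : E →+* M)
    (hρρ : ∀ x, ρ (ρ x) = x) (hvρ : ∀ x, Valued.v (ρ x) = Valued.v x) (hα : ρ α ≠ α) (hα1 : Valued.v α ≤ 1)
    (hint : ∀ z : M, Valued.v z ≤ 1 → Valued.v ((z - ρ z) / (α - ρ α)) ≤ 1)
    (hΘΘ : ∀ x, Θ (Θ x) = x) (hΘρ : ∀ x, Θ (ρ x) = ρ (Θ x)) (hvΘ : ∀ x, Valued.v (Θ x) = Valued.v x)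
    (hjv : ∀ c, Valued.v (jE c) ≤ 1 ↔ Valued.v c ≤ 1) (hjfix : ∀ z, ρ z = z ↔ ∃ c, jE c = z)
    (hjpow : ∀ (t : E) (n : ℤ), Valued.v (jE t) = Valued.v (jE ϖ) ^ n ↔ Valued.v t = Valued.v ϖ ^ n)
    (φ : (Fin 2 → E) →+ M) (hφs : ∀ (c : E) (x : Fin 2 → E), φ (c • x) = jE c * φ x) (hφi : Function.Injective φ) (hφo : Function.Surjective φ)
    {γ₂ : GL (Fin 2) E} {lam h : M} (hφγ : ∀ x, φ ((γ₂ : Matrix (Fin 2) (Fin 2) E).mulVec x) = lam * φ x)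
    (hh : h ≠ 0) (hform : ∀ x y, jE (pairing σ H₂ x y) = h * Θ (φ x) * φ y + ρ (h * Θ (φ x) * φ y))
    (u : GL (Fin 1) E) (hum : Valued.v (((u : Matrix (Fin 1) (Fin 1) E) 0 0) - 1) ≤ Valued.v (ϖ ^ mstarOfRecord d))
    {ε : M} {ξ : E} (hεξ : ε * Θ ε = jE ξ) (hσξ : σ ξ = ξ) (hξ1 : Valued.v ξ = 1) (hξN : ¬ ∃ z : E, z * σ z = ξ)
    (ℓ : ℕ) {mc : ℕ} (hmc : mstarOfRecord d ≤ mc) (j a : ℕ)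
    (hclean : ∀ g₂ : GL (Fin 2) E, (latt (g₂ : Matrix (Fin 2) (Fin 2) E)).toAddSubgroup.map φ ∈ levelSet ρ Θ α (jE ϖ) h j a →
      LatticeNearTransvShell ϖ ℓ (mstarOfRecord d) ((((endoGL (γ₂, u) : GL (Fin 3) E) : Matrix (Fin 3) (Fin 3) E) - 1))
        (latt ((endoGL (g₂, (1 : GL (Fin 1) E)) : GL (Fin 3) E) : Matrix (Fin 3) (Fin 3) E)) →
      {z : E | ∃ y ∈ latt ((endoGL (g₂, (1 : GL (Fin 1) E)) : GL (Fin 3) E) : Matrix (Fin 3) (Fin 3) E), Valued.v ((ϖ ^ (mstarOfRecord d))⁻¹ * (z - pairing σ (!![H₂ 0 0, 0, H₂ 0 1; 0, hW, 0; H₂ 1 0, 0, H₂ 1 1] : Matrix (Fin 3) (Fin 3) E) y (((((endoGL (γ₂, u) : GL (Fin 3) E) : Matrix (Fin 3) (Fin 3) E) - 1)) *ᵥ y))) ≤ 1} = valueSetMod σ ϖ (mstarOfRecord d) (xPlus σ ϖ d) →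
      LatticeInLevel ϖ mc (((((endoGL (γ₂, u) : GL (Fin 3) E) : Matrix (Fin 3) (Fin 3) E) - 1)) * ((((endoGL (γ₂, u) : GL (Fin 3) E) : Matrix (Fin 3) (Fin 3) E) - 1)))
        (latt ((endoGL (g₂, (1 : GL (Fin 1) E)) : GL (Fin 3) E) : Matrix (Fin 3) (Fin 3) E)))
    (hdich : ∀ g₂ : GL (Fin 2) E, (latt (g₂ : Matrix (Fin 2) (Fin 2) E)).toAddSubgroup.map φ ∈ levelSet ρ Θ α (jE ϖ) h j a →
      LatticeNearTransvShell ϖ ℓ mc ((((endoGL (γ₂, u) : GL (Fin 3) E) : Matrix (Fin 3) (Fin 3) E) - 1))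
        (latt ((endoGL (g₂, (1 : GL (Fin 1) E)) : GL (Fin 3) E) : Matrix (Fin 3) (Fin 3) E)) →
      ∃ e : E, σ e = e ∧ Valued.v e = 1 ∧
        {z : E | ∃ y ∈ latt ((endoGL (g₂, (1 : GL (Fin 1) E)) : GL (Fin 3) E) : Matrix (Fin 3) (Fin 3) E), Valued.v ((ϖ ^ (mstarOfRecord d))⁻¹ * (z - pairing σ (!![H₂ 0 0, 0, H₂ 0 1; 0, hW, 0; H₂ 1 0, 0, H₂ 1 1] : Matrix (Fin 3) (Fin 3) E) y (((((endoGL (γ₂, u) : GL (Fin 3) E) : Matrix (Fin 3) (Fin 3) E) - 1)) *ᵥ y))) ≤ 1} = valueSetMod σ ϖ (mstarOfRecord d) (e • xPlus σ ϖ d)) :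
    ((levelSet ρ Θ α (jE ϖ) h j a ∩ {Λ | ∃ g₂ : GL (Fin 2) E, (latt (g₂ : Matrix (Fin 2) (Fin 2) E)).toAddSubgroup.map φ = Λ ∧
        (LatticeNearTransvShell ϖ ℓ (mstarOfRecord d) ((((endoGL (γ₂, u) : GL (Fin 3) E) : Matrix (Fin 3) (Fin 3) E) - 1)) (latt ((endoGL (g₂, (1 : GL (Fin 1) E)) : GL (Fin 3) E) : Matrix (Fin 3) (Fin 3) E)) ∧
          {z : E | ∃ y ∈ latt ((endoGL (g₂, (1 : GL (Fin 1) E)) : GL (Fin 3) E) : Matrix (Fin 3) (Fin 3) E), Valued.v ((ϖ ^ (mstarOfRecord d))⁻¹ * (z - pairing σ (!![H₂ 0 0, 0, H₂ 0 1; 0, hW, 0; H₂ 1 0, 0, H₂ 1 1] : Matrix (Fin 3) (Fin 3) E) y (((((endoGL (γ₂, u) : GL (Fin 3) E) : Matrix (Fin 3) (Fin 3) E) - 1)) *ᵥ y))) ≤ 1} = valueSetMod σ ϖ (mstarOfRecord d) (xPlus σ ϖ d))}).ncard : ℤ) -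
      ((levelSet ρ Θ α (jE ϖ) h j a ∩ {Λ | ∃ g₂ : GL (Fin 2) E, (latt (g₂ : Matrix (Fin 2) (Fin 2) E)).toAddSubgroup.map φ = Λ ∧
        (LatticeNearTransvShell ϖ ℓ mc ((((endoGL (γ₂, u) : GL (Fin 3) E) : Matrix (Fin 3) (Fin 3) E) - 1)) (latt ((endoGL (g₂, (1 : GL (Fin 1) E)) : GL (Fin 3) E) : Matrix (Fin 3) (Fin 3) E)) ∧
          ¬ {z : E | ∃ y ∈ latt ((endoGL (g₂, (1 : GL (Fin 1) E)) : GL (Fin 3) E) : Matrix (Fin 3) (Fin 3) E), Valued.v ((ϖ ^ (mstarOfRecord d))⁻¹ * (z - pairing σ (!![H₂ 0 0, 0, H₂ 0 1; 0, hW, 0; H₂ 1 0, 0, H₂ 1 1] : Matrix (Fin 3) (Fin 3) E) y (((((endoGL (γ₂, u) : GL (Fin 3) E) : Matrix (Fin 3) (Fin 3) E) - 1)) *ᵥ y))) ≤ 1} = valueSetMod σ ϖ (mstarOfRecord d) (xPlus σ ϖ d))}).ncard : ℤ) = 0 := by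
  classical
  -- scalars
  have hvσ : ∀ a, Valued.v (σ a) = Valued.v a := hD.2.1
  have hϖ : Valued.v ϖ = exp (-1 : ℤ) := hD.2.2.1
  have hvϖ0 : Valued.v ϖ ≠ 0 := by rw [hϖ]; exact exp_ne_zero
  have hϖ0 : ϖ ≠ 0 := fun h0 => by rw [h0, map_zero] at hvϖ0; exact hvϖ0 rfl
  have hϖ1 : Valued.v ϖ ≤ 1 := by rw [hϖ, ← exp_zero, exp_le_exp]; norm_num
  have hρξ : ρ (jE ξ) = jE ξ := (hjfix _).2 ⟨ξ, rfl⟩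
  have hξM1 : Valued.v (jE ξ) = 1 := by
    have h0 := (hjpow ξ 0).2 (by rw [zpow_zero]; exact hξ1)
    rwa [zpow_zero] at h0
  have hξM0 : jE ξ ≠ 0 := fun h0 => by rw [h0, map_zero] at hξM1; exact zero_ne_one hξM1
  have hε0 : ε ≠ 0 := ne_zero_of_mul_map_eq hεξ hξM0
  -- the inverse flip
  obtain ⟨hσξ', hξ'1, hξ'N⟩ := inv_fixed_unit_not_norm hσξ hξ1 hξN
  have hεξ' : ε⁻¹ * Θ ε⁻¹ = jE ξ⁻¹ := by rw [inv_mul_map_inv_eq hεξ, map_inv₀]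
  -- the two flips as plane similitudes
  obtain ⟨g, hg⟩ := exists_GL_mulVec_eq_mul jE φ hφs hφi hφo hε0
  obtain ⟨g', hg'⟩ := exists_GL_mulVec_eq_mul jE φ hφs hφi hφo (inv_ne_zero hε0)
  have hcomm : ∀ {gg : GL (Fin 2) E} {zz : M}, (∀ x : Fin 2 → E, φ ((gg : Matrix (Fin 2) (Fin 2) E) *ᵥ x) = zz * φ x) →
      ((((endoGL (γ₂, u) : GL (Fin 3) E) : Matrix (Fin 3) (Fin 3) E) - 1)) * ((endoGL (gg, (1 : GL (Fin 1) E)) : GL (Fin 3) E) : Matrix (Fin 3) (Fin 3) E) =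
        ((endoGL (gg, (1 : GL (Fin 1) E)) : GL (Fin 3) E) : Matrix (Fin 3) (Fin 3) E) * ((((endoGL (γ₂, u) : GL (Fin 3) E) : Matrix (Fin 3) (Fin 3) E) - 1)) :=
    fun hgg => endoGL_sub_one_mul_endoGL_one_comm (mul_eq_mul_of_lineModel φ hφi hφγ hgg) u
  -- transport of the presentation, the vertex and the shell along a flip matrix
  have hpres : ∀ {gg : GL (Fin 2) E} {zz : M}, (∀ x : Fin 2 → E, φ ((gg : Matrix (Fin 2) (Fin 2) E) *ᵥ x) = zz * φ x) → ∀ g₂ : GL (Fin 2) E,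
      (latt (((gg * g₂ : GL (Fin 2) E)) : Matrix (Fin 2) (Fin 2) E)).toAddSubgroup.map φ = zz • (latt (g₂ : Matrix (Fin 2) (Fin 2) E)).toAddSubgroup.map φ :=
    fun hgg g₂ => by rw [Units.val_mul, latt_mul, map_map_toLin'_eq_smul φ hgg]
  have hvert : ∀ gg g₂ : GL (Fin 2) E, latt ((endoGL (gg * g₂, (1 : GL (Fin 1) E)) : GL (Fin 3) E) : Matrix (Fin 3) (Fin 3) E) =
      mapGL (endoGL (gg, (1 : GL (Fin 1) E))) (latt ((endoGL (g₂, (1 : GL (Fin 1) E)) : GL (Fin 3) E) : Matrix (Fin 3) (Fin 3) E)) := fun gg g₂ => by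
    rw [endoGL_mul_one, mapGL_latt]
  have hshell : ∀ {gg : GL (Fin 2) E} {zz : M}, (∀ x : Fin 2 → E, φ ((gg : Matrix (Fin 2) (Fin 2) E) *ᵥ x) = zz * φ x) → ∀ (g₂ : GL (Fin 2) E) (k k' : ℕ),
      LatticeNearTransvShell ϖ k k' ((((endoGL (γ₂, u) : GL (Fin 3) E) : Matrix (Fin 3) (Fin 3) E) - 1))
          (latt ((endoGL (gg * g₂, (1 : GL (Fin 1) E)) : GL (Fin 3) E) : Matrix (Fin 3) (Fin 3) E)) ↔
        LatticeNearTransvShell ϖ k k' ((((endoGL (γ₂, u) : GL (Fin 3) E) : Matrix (Fin 3) (Fin 3) E) - 1))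
          (latt ((endoGL (g₂, (1 : GL (Fin 1) E)) : GL (Fin 3) E) : Matrix (Fin 3) (Fin 3) E)) :=
    fun hgg g₂ k k' => by rw [hvert]; exact latticeNearTransvShell_mapGL_iff_of_comm _ (hcomm hgg) ϖ k k' _
  -- the exchange
  let τ : AddSubgroup M ≃ AddSubgroup M :=
    ⟨fun Λ => ε • Λ, fun Λ => ε⁻¹ • Λ, fun Λ => by simp only [smul_smul, inv_mul_cancel₀ hε0, one_smul],
      fun Λ => by simp only [smul_smul, mul_inv_cancel₀ hε0, one_smul]⟩
  refine natCast_ncard_inter_sub_eq_zero_of_equiv _ τ (fun Λ => smul_mem_levelSet_iff_of_flip hεξ hρξ hξM1 (jE ϖ) h j a Λ) _ _ ?_ ?_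
  · -- `+ ↦ −′` under `Λ ↦ ε • Λ`
    rintro Λ hΛ ⟨g₂, hg₂Λ, hsh, hV⟩
    have hmem : (latt (g₂ : Matrix (Fin 2) (Fin 2) E)).toAddSubgroup.map φ ∈ levelSet ρ Θ α (jE ϖ) h j a := by rw [hg₂Λ]; exact hΛ
    refine ⟨g * g₂, by rw [hpres hg, hg₂Λ]; rfl, ?_, ?_⟩
    · -- clean at `m_c` by `hclean`, then transported
      rw [hshell hg]
      exact ⟨hsh.1, hsh.2.1, hclean g₂ hmem hsh hV⟩
    · -- the letter becomes `ξ·V₊`, which is not `V₊` at the level of record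
      rw [valueSet_axis_flip_eq_image_mul hvσ hϖ H₂ hhW jE hρρ hvρ hα hα1 hint hΘΘ hΘρ hvΘ hjv hjfix hjpow φ hφi hφγ hh hform u _ hum hεξ hξ1 hg j a hmem, hV]
      refine not_eq_valueSetMod_plus_of_image_mul_eq_plus hD hσξ' hξ'1 hξ'N ?_
      rw [Set.image_image]
      have hξ0 : ξ ≠ 0 := fun h0 => by rw [h0, map_zero] at hξ1; exact zero_ne_one hξ1
      simp only [inv_mul_cancel_left₀ hξ0, Set.image_id']
  · -- `−′ ↦ +` under `Λ ↦ ε⁻¹ • Λ`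
    rintro Λ hΛ ⟨g₂, hg₂Λ, hsh, hV⟩
    have hmem : (latt (g₂ : Matrix (Fin 2) (Fin 2) E)).toAddSubgroup.map φ ∈ levelSet ρ Θ α (jE ϖ) h j a := by rw [hg₂Λ]; exact hΛ
    refine ⟨g' * g₂, by rw [hpres hg', hg₂Λ]; rfl, ?_, ?_⟩
    · -- the `m*`-shell from the `m_c`-shell (antitone), then transported
      rw [hshell hg']
      exact ⟨hsh.1, hsh.2.1, latticeInLevel_of_le' hϖ1 hmc hsh.2.2⟩
    · -- the letter becomes `ξ⁻¹·VS`, which IS `V₊` given the (A″) witness and `¬ VS = V₊`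
      rw [valueSet_axis_flip_eq_image_mul hvσ hϖ H₂ hhW jE hρρ hvρ hα hα1 hint hΘΘ hΘρ hvΘ hjv hjfix hjpow φ hφi hφγ hh hform u _ hum hεξ' hξ'1 hg' j a hmem]
      exact (image_mul_eq_valueSetMod_plus_iff_not hD hσξ' hξ'1 hξ'N (hdich g₂ hmem hsh)).2 hV

end Summit.HodgeConjecture.HodgeConjecture.Cruxes.H413.F0P3cDyRamAxisColumnZero

end
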